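import Summits.ValiantsHypothesis.ValiantsHypothesis.Theorems.LacunarySymmetroidMatrixDescartesDoorA26WallBubblingWeylFrameDictionary
import Summits.ValiantsHypothesis.ValiantsHypothesis.Theorems.LacunarySymmetroidMatrixDescartesDoorA26WallBubblingHingeExclusion
import Summits.ValiantsHypothesis.ValiantsHypothesis.Theorems.LacunarySymmetroidMatrixDescartesDoorA26WallBubblingHigherMinors

/-!
# Wall bubbling for `DoorA26` — obligation (W): the HINGE EXCLUSION AT A WEYL FACE in the currency of the cluster packages (frame letters off the merged one)

HONEST FRAMING.  Helper theorem for the line `Cruxes/DoorA26/Lines/wall_bubbling.lean` (crux stmt-ValiantsHypothesis-19979 `DoorA26`; OPEN, typed,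
never asserted), W2 seat val-sym-door-p1 g16; obligation (W), residual `NoTightChain26NC` (statement file `wall_bubbling_ConfluentDoor.lean` rev 6).
Def-free; nothing here bears on `DoorA26`, `MatrixDescartes` (stmt-ValiantsHypothesis-18050) or `VP ≠ VNP`; registers unchanged.

THE THEOREM (`weyl_hinge_exclusion_of_packages`).  Data as delivered PER CLUSTER by W2 #22/#26 (`confluentClusters` / `tightChain`): exponents `δ^ν → δ⋆`
at a Weyl face (positions `0, 5` coalescing), symmetric letters `U^ν`, two clusters with centres `s₁^ν, s₂^ν` (`s₂ − s₁ → +∞`), normalisers `μ₁, μ₂ > 0`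
and frame-package limits `polar(frame_c a, frame_c b)/μ_c → Γ_c a b` for ALL frame letters `a, b` (the literal if-then-else frame of #26).  If four frame
letters `e = (a,b,cc,d)`, NONE the merged letter `0`, have `δ⋆ a < δ⋆ b < δ⋆ cc < δ⋆ d`, the member `(b,cc)` is alive in BOTH `Γ₁, Γ₂` and no other pair of
non-merged letters shares its value, and `(a,d)` is alive on its side, then `False`.  Proof: the Weyl frame dictionary (#40: off the merged letter the frame
Gram is the diagonally rescaled raw Gram `G′`, realisable, merged row zeroed) feeds `false_of_hinge_strictly_between_of_packages` (#35) after passing to a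
tail on which every member keeps the side of its limit value.  This is the by-name form of the transvection-free kills of the located Weyl census (hub
re-run R3); with the tight-chain conclusions of #26/#28 (hinge = the shared alive value of consecutive clusters; aliveness of flanked members inside
`Λ_c ∪ Λ_{c+1}`) it removes those profiles from `NoTightChain26NC` — the wiring against the statement file's binder is the line lead's.

[this work] the wiring; ingredients #35, #40, W1 #21.
-/

-- `Summit.ValiantsHypothesis.ValiantsHypothesis.…` repeats a component by the D-0017 layout
-- (single-conjunct summit), which the `dupNamespace` linter flags; the name is mandated.
set_option linter.dupNamespace false

namespace Summit.ValiantsHypothesis.ValiantsHypothesis.Theorems.LacunarySymmetroidMatrixDescartes.WallBubbling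

open Finset Filter Topology
open Bubbling (polar Realisable)

/-- **WEYL-FACE HINGE EXCLUSION in package currency** (see the module docstring).  The approach side of the two coalescing exponents is not
assumed: the proof extracts a subsequence on which `δ^ν 0 ≤ δ^ν 5` (or the reverse) holds throughout, which decides the side of the merged members sharing
the hinge value; all other members take the side of their limit value on a tail. [this work] -/
theorem weyl_hinge_exclusion_of_packages
    (δs : ℕ → Fin 6 → ℝ) (δ0 : Fin 6 → ℝ) (hδ : ∀ l, Tendsto (fun ν => δs ν l) atTop (𝓝 (δ0 l))) (h05 : δ0 5 = δ0 0)
    (U : ℕ → Fin 6 → Matrix (Fin 2) (Fin 2) ℝ) (hU : ∀ ν l, (U ν l).IsSymm)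
    (s₁ s₂ μ₁ μ₂ : ℕ → ℝ) (hμ₁ : ∀ ν, 0 < μ₁ ν) (hμ₂ : ∀ ν, 0 < μ₂ ν)
    (hL : Tendsto (fun ν => s₂ ν - s₁ ν) atTop atTop)
    (Γ₁ Γ₂ : Fin 6 → Fin 6 → ℝ)
    (hpkg₁ : ∀ a b : Fin 6, Tendsto (fun ν => polar
      (if a = 0 then Real.exp (δs ν 0 * s₁ ν) • U ν 0 + Real.exp (δs ν 5 * s₁ ν) • U ν 5
        else if a = 5 then (δs ν 5 - δs ν 0) • (Real.exp (δs ν 5 * s₁ ν) • U ν 5)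
        else Real.exp (δs ν a * s₁ ν) • U ν a)
      (if b = 0 then Real.exp (δs ν 0 * s₁ ν) • U ν 0 + Real.exp (δs ν 5 * s₁ ν) • U ν 5
        else if b = 5 then (δs ν 5 - δs ν 0) • (Real.exp (δs ν 5 * s₁ ν) • U ν 5)
        else Real.exp (δs ν b * s₁ ν) • U ν b) / μ₁ ν) atTop (𝓝 (Γ₁ a b)))
    (hpkg₂ : ∀ a b : Fin 6, Tendsto (fun ν => polar
      (if a = 0 then Real.exp (δs ν 0 * s₂ ν) • U ν 0 + Real.exp (δs ν 5 * s₂ ν) • U ν 5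
        else if a = 5 then (δs ν 5 - δs ν 0) • (Real.exp (δs ν 5 * s₂ ν) • U ν 5)
        else Real.exp (δs ν a * s₂ ν) • U ν a)
      (if b = 0 then Real.exp (δs ν 0 * s₂ ν) • U ν 0 + Real.exp (δs ν 5 * s₂ ν) • U ν 5
        else if b = 5 then (δs ν 5 - δs ν 0) • (Real.exp (δs ν 5 * s₂ ν) • U ν 5)
        else Real.exp (δs ν b * s₂ ν) • U ν b) / μ₂ ν) atTop (𝓝 (Γ₂ a b)))
    (e : Fin 4 → Fin 6) (he : ∀ i, e i ≠ 0)
    (hab : δ0 (e 0) < δ0 (e 1)) (hbc : δ0 (e 1) < δ0 (e 2)) (hcd : δ0 (e 2) < δ0 (e 3))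
    (hgen : ∀ p q : Fin 6, p ≠ 0 → q ≠ 0 → δ0 p + δ0 q = δ0 (e 1) + δ0 (e 2) → (p = e 1 ∧ q = e 2) ∨ (p = e 2 ∧ q = e 1))
    (hh1 : Γ₁ (e 1) (e 2) ≠ 0) (hh1' : Γ₁ (e 2) (e 1) ≠ 0) (hh2 : Γ₂ (e 1) (e 2) ≠ 0)
    (had : (δ0 (e 0) + δ0 (e 3) < δ0 (e 1) + δ0 (e 2) ∧ Γ₁ (e 0) (e 3) ≠ 0 ∧ Γ₁ (e 3) (e 0) ≠ 0) ∨
           (δ0 (e 1) + δ0 (e 2) < δ0 (e 0) + δ0 (e 3) ∧ Γ₂ (e 0) (e 3) ≠ 0 ∧ Γ₂ (e 3) (e 0) ≠ 0)) : False := by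
  classical
  -- Step 0: a subsequence along which the two coalescing exponents keep one order
  obtain ⟨φ, hφ, hφside⟩ : ∃ φ : ℕ → ℕ, StrictMono φ ∧
      ((∀ ν, δs (φ ν) 0 ≤ δs (φ ν) 5) ∨ (∀ ν, δs (φ ν) 5 ≤ δs (φ ν) 0)) := by
    by_cases hfreq : ∃ᶠ ν in atTop, δs ν 0 ≤ δs ν 5
    · obtain ⟨φ, hφ, h⟩ := Filter.extraction_of_frequently_atTop hfreq
      exact ⟨φ, hφ, Or.inl h⟩
    · have hev : ∀ᶠ ν in atTop, δs ν 5 ≤ δs ν 0 := by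
        rw [Filter.not_frequently] at hfreq
        exact hfreq.mono fun ν h => le_of_lt (not_le.mp h)
      obtain ⟨φ, hφ, h⟩ := Filter.extraction_of_frequently_atTop hev.frequently
      exact ⟨φ, hφ, Or.inr h⟩
  -- notation along the subsequence
  set δ' : ℕ → Fin 6 → ℝ := fun ν => δs (φ ν) with hδ'
  have hδφ : ∀ l, Tendsto (fun ν => δ' ν l) atTop (𝓝 (δ0 l)) := fun l => (hδ l).comp hφ.tendsto_atTop
  set mergedBelow : Prop := ∀ ν, δ' ν 0 ≤ δ' ν 5 with hmB
  have hside0 : mergedBelow ∨ ∀ ν, δ' ν 5 ≤ δ' ν 0 := hφside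
  -- the rescaled raw Gram (merged row zero) along the subsequence and its limits
  set G : ℕ → Matrix (Fin 6) (Fin 6) ℝ := fun ν => Matrix.of fun a b : Fin 6 =>
    if a = 0 ∨ b = 0 then 0
    else (if a = 5 then δ' ν 5 - δ' ν 0 else 1) * (if b = 5 then δ' ν 5 - δ' ν 0 else 1) * polar (U (φ ν) a) (U (φ ν) b) with hGdef
  set Γ₁' : Fin 6 → Fin 6 → ℝ := fun a b => if a = 0 ∨ b = 0 then 0 else Γ₁ a b with hΓ₁'
  set Γ₂' : Fin 6 → Fin 6 → ℝ := fun a b => if a = 0 ∨ b = 0 then 0 else Γ₂ a b with hΓ₂'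
  have hreal : ∀ ν, Realisable (G ν) := fun ν => realisable_frameGram (δ' ν) (U (φ ν)) (hU (φ ν))
  have hP₁ : ∀ p q, Tendsto (fun ν => G ν p q * Real.exp ((δ' ν p + δ' ν q) * s₁ (φ ν)) / μ₁ (φ ν)) atTop (𝓝 (Γ₁' p q)) := by
    intro p q
    by_cases h : p = 0 ∨ q = 0
    · have : ∀ ν, G ν p q = 0 := fun ν => by simp [hGdef, h]
      simp_rw [this, hΓ₁', if_pos h, zero_mul, zero_div]; exact tendsto_const_nhds
    · push Not at h
      have := frame_package_off_merged (fun ν => δs (φ ν)) (fun ν => U (φ ν)) (fun ν => s₁ (φ ν)) (fun ν => μ₁ (φ ν)) Γ₁ p q h.1 h.2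
        ((hpkg₁ p q).comp hφ.tendsto_atTop)
      simp_rw [hΓ₁', if_neg (not_or.mpr h)]
      refine this.congr' (Eventually.of_forall fun ν => ?_)
      simp [hGdef, h.1, h.2, hδ']
  have hP₂ : ∀ p q, Tendsto (fun ν => G ν p q * Real.exp ((δ' ν p + δ' ν q) * s₂ (φ ν)) / μ₂ (φ ν)) atTop (𝓝 (Γ₂' p q)) := by
    intro p q
    by_cases h : p = 0 ∨ q = 0
    · have : ∀ ν, G ν p q = 0 := fun ν => by simp [hGdef, h]
      simp_rw [this, hΓ₂', if_pos h, zero_mul, zero_div]; exact tendsto_const_nhds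
    · push Not at h
      have := frame_package_off_merged (fun ν => δs (φ ν)) (fun ν => U (φ ν)) (fun ν => s₂ (φ ν)) (fun ν => μ₂ (φ ν)) Γ₂ p q h.1 h.2
        ((hpkg₂ p q).comp hφ.tendsto_atTop)
      simp_rw [hΓ₂', if_neg (not_or.mpr h)]
      refine this.congr' (Eventually.of_forall fun ν => ?_)
      simp [hGdef, h.1, h.2, hδ']
  -- values, hinge, and a tail on which every member with limit value ≠ v keeps its side
  set v : ℝ := δ0 (e 1) + δ0 (e 2) with hv
  have hw : ∀ p q : Fin 6, Tendsto (fun ν => δ' ν p + δ' ν q) atTop (𝓝 (δ0 p + δ0 q)) := fun p q => (hδφ p).add (hδφ q)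
  have hvν : Tendsto (fun ν => δ' ν (e 1) + δ' ν (e 2)) atTop (𝓝 v) := hw _ _
  have hside : ∀ᶠ ν in atTop, ∀ pq : Fin 6 × Fin 6,
      (δ0 pq.1 + δ0 pq.2 < v → δ' ν pq.1 + δ' ν pq.2 ≤ δ' ν (e 1) + δ' ν (e 2)) ∧
      (v < δ0 pq.1 + δ0 pq.2 → δ' ν (e 1) + δ' ν (e 2) ≤ δ' ν pq.1 + δ' ν pq.2) := by
    refine eventually_all.mpr fun pq => ?_
    refine Filter.Eventually.and ?_ ?_
    · by_cases hlt : δ0 pq.1 + δ0 pq.2 < v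
      · have := ((hw pq.1 pq.2).sub hvν).eventually (gt_mem_nhds (sub_neg.mpr hlt))
        exact this.mono fun ν hν _ => by linarith
      · exact Eventually.of_forall fun ν h => absurd h hlt
    · by_cases hgt : v < δ0 pq.1 + δ0 pq.2
      · have := ((hw pq.1 pq.2).sub hvν).eventually (lt_mem_nhds (sub_pos.mpr hgt))
        exact this.mono fun ν hν _ => by linarith
      · exact Eventually.of_forall fun ν h => absurd h hgt
  obtain ⟨N₀, hN₀⟩ := eventually_atTop.mp hside
  have hshift : Tendsto (fun ν : ℕ => ν + N₀) atTop atTop := tendsto_add_atTop_nat N₀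
  -- which members share the hinge value: the hinge pair among non-merged letters; among merged members only `(0,q)`/`(q,0)` with `{5,q}` the hinge pair
  have he12 : e 1 ≠ e 2 := fun h => by rw [h] at hbc; exact lt_irrefl _ hbc
  have hmerged : ∀ p q : Fin 6, (p = 0 ∨ q = 0) → δ0 p + δ0 q = v →
      ∀ ν, (δ' ν p + δ' ν q) - (δ' ν (e 1) + δ' ν (e 2)) = δ' ν 0 - δ' ν 5 := by
    intro p q hpq hval ν
    -- replace the merged index by 5 in the limit value and identify the pair with the hinge
    have key : ∀ q : Fin 6, δ0 0 + δ0 q = v → q ≠ 0 ∧ ((5 = e 1 ∧ q = e 2) ∨ (5 = e 2 ∧ q = e 1)) := by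
      intro q hq
      have hq5 : δ0 5 + δ0 q = v := by rw [h05]; exact hq
      by_cases hq0 : q = 0
      · subst hq0
        have : δ0 5 + δ0 5 = v := by rw [h05]; rw [h05] at hq5; exact hq5
        rcases hgen 5 5 (by decide) (by decide) this with ⟨h1, h2⟩ | ⟨h1, h2⟩
        · exact absurd (h1.symm.trans h2) he12
        · exact absurd (h2.symm.trans h1) he12
      · exact ⟨hq0, hgen 5 q (by decide) hq0 hq5⟩
    rcases hpq with rfl | rfl
    · obtain ⟨-, h⟩ := key q hval
      rcases h with ⟨h1, h2⟩ | ⟨h1, h2⟩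
      · rw [← h1, h2]; ring
      · rw [← h1, h2]; ring
    · rw [add_comm] at hval
      obtain ⟨-, h⟩ := key p hval
      rcases h with ⟨h1, h2⟩ | ⟨h1, h2⟩
      · rw [← h1, h2]; ring
      · rw [← h1, h2]; ring
  refine false_of_hinge_strictly_between_of_packages
    (fun ν => G (ν + N₀)) e ?_
    (fun ν => δ' (ν + N₀)) δ0 (fun l => (hδφ l).comp hshift) hab hbc hcd
    (fun ν => s₁ (φ (ν + N₀))) (fun ν => s₂ (φ (ν + N₀))) (fun ν => μ₁ (φ (ν + N₀))) (fun ν => μ₂ (φ (ν + N₀)))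
    (fun ν => hμ₁ _) (fun ν => hμ₂ _) ((hL.comp hφ.tendsto_atTop).comp hshift)
    Γ₁' Γ₂' (fun p q => δ0 p + δ0 q < v ∨ (δ0 p + δ0 q = v ∧ ((p ≠ 0 ∧ q ≠ 0) ∨ mergedBelow)))
    ?_ ?_ (fun p q _ => (hP₁ p q).comp hshift) (fun p q _ => (hP₂ p q).comp hshift)
    ((hP₁ (e 1) (e 2)).comp hshift) ((hP₂ (e 1) (e 2)).comp hshift) ?_ ?_ ?_
  · intro ν; exact SecondOrder.realisable_det_submatrix (hreal (ν + N₀)) (by norm_num) e e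
  · -- side `below`
    intro p q hB ν
    rcases hB with hlt | ⟨heq, hcase⟩
    · exact (hN₀ (ν + N₀) (Nat.le_add_left _ _) (p, q)).1 hlt
    · rcases hcase with ⟨hp, hq⟩ | hmb
      · rcases hgen p q hp hq heq with ⟨rfl, rfl⟩ | ⟨rfl, rfl⟩
        · exact le_rfl
        · exact (add_comm _ _).le
      · by_cases hm : p = 0 ∨ q = 0
        · have := hmerged p q hm heq (ν + N₀)
          have h0 := hmb (ν + N₀)
          linarith
        · push Not at hm
          rcases hgen p q hm.1 hm.2 heq with ⟨rfl, rfl⟩ | ⟨rfl, rfl⟩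
          · exact le_rfl
          · exact (add_comm _ _).le
  · -- side `above`
    intro p q hB ν
    have hge : ¬ δ0 p + δ0 q < v := fun h => hB (Or.inl h)
    rcases lt_or_eq_of_le (not_lt.mp hge) with hgt | heq
    · exact (hN₀ (ν + N₀) (Nat.le_add_left _ _) (p, q)).2 hgt
    · -- value = v but not sent below: merged member and ¬ mergedBelow
      have hm : p = 0 ∨ q = 0 := by
        by_contra hnm
        push Not at hnm
        exact hB (Or.inr ⟨heq.symm, Or.inl hnm⟩)
      have hnmb : ¬ mergedBelow := fun h => hB (Or.inr ⟨heq.symm, Or.inr h⟩)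
      have habove : ∀ ν, δ' ν 5 ≤ δ' ν 0 := hside0.resolve_left hnmb
      have := hmerged p q hm heq.symm (ν + N₀)
      have h0 := habove (ν + N₀)
      linarith
  · simpa [hΓ₁', he] using hh1
  · simpa [hΓ₂', he] using hh2
  · -- aliveness of the four members of the order-reversing matching, on their sides
    intro pq hpq
    simp only [List.mem_cons, List.not_mem_nil, or_false] at hpq
    have hne03 : δ0 (e 0) + δ0 (e 3) ≠ v := by
      rcases had with ⟨hlt, -⟩ | ⟨hgt, -⟩
      · exact ne_of_lt hlt
      · exact (ne_of_lt hgt).symm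
    rcases hpq with rfl | rfl | rfl | rfl
    · rcases had with ⟨hlt, -, hne⟩ | ⟨hgt, -, hne⟩
      · left; refine ⟨Or.inl (by simp only; linarith), ?_⟩; simpa [hΓ₁', he] using hne
      · right; refine ⟨?_, by simpa [hΓ₂', he] using hne⟩
        simp only [not_or, not_lt, not_and]
        exact ⟨by linarith, fun h => absurd (by linarith : δ0 (e 0) + δ0 (e 3) = v) hne03⟩
    · left; exact ⟨Or.inr ⟨by simp only [hv]; ring, Or.inl ⟨he 2, he 1⟩⟩, by simpa [hΓ₁', he] using hh1'⟩
    · left; exact ⟨Or.inr ⟨rfl, Or.inl ⟨he 1, he 2⟩⟩, by simpa [hΓ₁', he] using hh1⟩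
    · rcases had with ⟨hlt, hne, -⟩ | ⟨hgt, hne, -⟩
      · left; refine ⟨Or.inl hlt, ?_⟩; simpa [hΓ₁', he] using hne
      · right; refine ⟨?_, by simpa [hΓ₂', he] using hne⟩
        simp only [not_or, not_lt, not_and]
        exact ⟨le_of_lt hgt, fun h => absurd h hne03⟩

end Summit.ValiantsHypothesis.ValiantsHypothesis.Theorems.LacunarySymmetroidMatrixDescartes.WallBubbling
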